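import Summits.ValiantsHypothesis.ValiantsHypothesis.Theorems.KPlusLogSqLawTropicalBToeplitzAffineWrap

/-!
# Route `KPlusLogSqLaw`, crux `TropicalB` — linear Toeplitz instances: duality certificates, two-displacement rigidity,
# and the TIGHT slopes of Conjecture T

HONEST FRAMING.  Helper toward the registered stubs `stub_tropThin` / `stub_tropFat` of
`Cruxes/TropicalB/Lines/birth.lean` (crux `Summit.ValiantsHypothesis.ValiantsHypothesis.Theses.KPlusLogSqLaw.TropicalB`,
ledger item `stmt-ValiantsHypothesis-19771`, route `KPlusLogSqLaw`; cell `pub-symmetroid`, seat `val-sym-trop-p3`,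
2026-08-26).  Structural lemmas for the cell's Conjecture T — the bound `Φ` on pairwise distinct unique optima of a LINEAR
Toeplitz parametric assignment instance that is the hypothesis of `toeplitz_chain_le_of_linearBound`
(`…TropicalBToeplitzReduction`).  Nothing here bounds `Φ` in general, nothing bounds `TropicalB` for general designs, and
nothing bears on `KPlusLogSqLaw`, `MatrixDescartes` or `VP ≠ VNP`.

THE OBJECT (as in `…TropicalBToeplitzAffineWrap`).  Slopes `ψ`, intercepts `α : ℤ → ℤ` on the integer displacement
`δ = a − b` of an entry; weight `W_θ(σ) = Σ_b (θ ψ(σ b − b) + α(σ b − b))`; admissible displacements `P`; a chain is a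
family of pairwise distinct permutations each the UNIQUE maximiser of `W_{θ'_k}` among admissible permutations.

WHAT IS HERE.
* `toeplitz_opt_eq_of_potential` — LP DUALITY CERTIFICATE: if potentials `r, c` dominate the cost on admissible entries,
  `θ ψ(a − b) + α(a − b) ≤ r a + c b`, with equality along an admissible permutation `π`, then `π` is optimal, so the
  unique optimum (if any) IS `π`. [folklore: weak duality of the assignment LP]
* `perm_eq_of_two_displacements` — TWO-DISPLACEMENT RIGIDITY: two permutations of `Fin n` whose displacements all lie in
  the same two-element set `{u, v}` are EQUAL (strong induction along the positions: the preimage of `b + v` decides).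
  So a «two-phase» displacement profile is realised by at most one permutation — the block rotations
  `exists_perm_two_displacements` (`ℓ ∣ m`, displacements `p` and `p − ℓ`: the `m/ℓ` consecutive blocks of length `ℓ`, each
  rotated by `p`; `ℓ = m` are the rotations of the m-phase lemma).
* `toeplitz_twoPhase_opt_eq` — the ONE-PARAMETER (Lagrangian) certificate: if for some `L > 0`, `Λ`, `Mx` the function
  `δ ↦ L·(θ ψ(δ) + α(δ)) − Λ·δ` is `≤ Mx` on admissible entries and `= Mx` along an admissible `π`, then the unique optimum
  is `π` (the displacements of a permutation sum to `0`, so `L·W_θ(σ) ≤ n·Mx = L·W_θ(π)`).  With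
  `toeplitz_twoPhase_opt_eq_of_pair`: if the maximum `Mx` is attained at two displacement VALUES `u ≠ v` and some admissible
  permutation has all its displacements in `{u, v}`, that permutation is the unique optimum.  This is the exact content of
  «the uncapacitated two-point relaxation of the Toeplitz assignment problem is tight at `θ`»: its optimum is a block
  rotation, ONE permutation for the whole range of such `θ`.
* `toeplitz_twoPhase_pairs_injective`, `toeplitz_twoPhase_chain_le` — consequently, along any chain, the indices carrying
  a two-phase certificate with value pair `(u_k, v_k)` are pairwise distinct in `(u_k, v_k)`; with `0 ≤ u_k < n` and
  `0 ≤ −v_k < n` there are at most `n²` of them.  READING for Conjecture T: the relaxation-TIGHT slopes contribute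
  `O(n²)` (on paper `O(n)`: the certifying pairs are edges of the spatial hull of `{(δ, ψ δ, α δ)}` crossing `δ = 0`); the
  open part of Conjecture T is the ROUNDING regime, where the straddling pair `(p, −q)` of the relaxation has `p + q ∤ m`.

References: folklore (assignment LP duality; Lagrangian relaxation of the mean-zero constraint); `sum_displacement_eq_zero`
(`…TropicalBToeplitzAffineWrap`); the reduction `toeplitz_chain_le_of_linearBound` (`…TropicalBToeplitzReduction`, p429098);
seat memo `HOME/val-sym-trop-p2/REGISTERS.md` §R7 (Conjecture T, data).
-/

set_option linter.dupNamespace false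
set_option autoImplicit false

namespace Summit.ValiantsHypothesis.ValiantsHypothesis.Theorems.KPlusLogSqLaw

open scoped BigOperators
open Finset

section TwoPhase

variable {n : ℕ}

/-- **LP duality certificate for a linear Toeplitz instance.**  If `θ ψ(a − b) + α(a − b) ≤ r a + c b` on every
admissible entry, with equality along the admissible permutation `π`, then every admissible permutation weighs at most
`Σ r + Σ c = W_θ(π)`; hence a permutation `τ` that is the UNIQUE maximiser among admissible permutations equals `π`.
[folklore] -/
theorem toeplitz_opt_eq_of_potential (ψ α : ℤ → ℤ) (P : ℤ → Prop) (θ : ℤ) (r c : Fin n → ℤ)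
    (hrc : ∀ a b : Fin n, P ((a : ℤ) - b) → θ * ψ ((a : ℤ) - b) + α ((a : ℤ) - b) ≤ r a + c b)
    (π : Equiv.Perm (Fin n)) (hπP : ∀ b, P ((π b : ℤ) - b))
    (hπ : ∀ b, θ * ψ ((π b : ℤ) - b) + α ((π b : ℤ) - b) = r (π b) + c b)
    (τ : Equiv.Perm (Fin n)) (hτP : ∀ b, P ((τ b : ℤ) - b))
    (huniq : ∀ σ : Equiv.Perm (Fin n), σ ≠ τ → (∀ b, P ((σ b : ℤ) - b)) →
      ∑ b, (θ * ψ ((σ b : ℤ) - b) + α ((σ b : ℤ) - b)) < ∑ b, (θ * ψ ((τ b : ℤ) - b) + α ((τ b : ℤ) - b))) :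
    τ = π := by
  by_contra hne
  have hlt := huniq π (Ne.symm hne) hπP
  have h1 : ∑ b, (θ * ψ ((τ b : ℤ) - b) + α ((τ b : ℤ) - b)) ≤ ∑ a, r a + ∑ b, c b :=
    calc ∑ b, (θ * ψ ((τ b : ℤ) - b) + α ((τ b : ℤ) - b)) ≤ ∑ b, (r (τ b) + c b) :=
          sum_le_sum fun b _ => hrc (τ b) b (hτP b)
      _ = ∑ b, r (τ b) + ∑ b, c b := sum_add_distrib
      _ = ∑ a, r a + ∑ b, c b := by rw [Equiv.sum_comp τ r]
  have h2 : ∑ b, (θ * ψ ((π b : ℤ) - b) + α ((π b : ℤ) - b)) = ∑ a, r a + ∑ b, c b :=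
    calc ∑ b, (θ * ψ ((π b : ℤ) - b) + α ((π b : ℤ) - b)) = ∑ b, (r (π b) + c b) :=
          sum_congr rfl fun b _ => hπ b
      _ = ∑ b, r (π b) + ∑ b, c b := sum_add_distrib
      _ = ∑ a, r a + ∑ b, c b := by rw [Equiv.sum_comp π r]
  exact absurd (h2 ▸ hlt) (not_lt.mpr h1)

/-- Rigidity step: if `σ` and `τ` agree on all positions before `b`, all displacements of `σ` lie in `{x, y}` with
`y < x`, and `σ b − b = x` while `τ b − b = y`, contradiction — the `σ`-preimage of `τ b` would be `b` itself or the
earlier position `b + y − x`, where `σ` and `τ` agree. [folklore] -/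
theorem false_of_two_displacements_step (σ τ : Equiv.Perm (Fin n)) (x y : ℤ) (hxy : y < x)
    (hσ : ∀ b, (σ b : ℤ) - b = x ∨ (σ b : ℤ) - b = y) (b : Fin n)
    (hagree : ∀ b' : Fin n, (b' : ℕ) < (b : ℕ) → σ b' = τ b')
    (hb : (σ b : ℤ) - b = x) (hb' : (τ b : ℤ) - b = y) : False := by
  set a := σ.symm (τ b) with ha
  have hσa : σ a = τ b := by rw [ha, Equiv.apply_symm_apply]
  rcases hσ a with h | h
  · -- `a = b + y − x < b`: agreement gives `τ a = τ b`, so `a = b`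
    have hlt : (a : ℕ) < (b : ℕ) := by
      have : (σ a : ℤ) = τ b := by exact_mod_cast congrArg Fin.val hσa
      omega
    have hτa : τ a = τ b := by rw [← hagree a hlt, hσa]
    have : a = b := τ.injective hτa
    omega
  · -- `a = b`: then `σ b = τ b`, contradicting `x ≠ y`
    have hab : (a : ℕ) = (b : ℕ) := by
      have : (σ a : ℤ) = τ b := by exact_mod_cast congrArg Fin.val hσa
      omega
    have hab' : a = b := Fin.ext hab
    rw [hab'] at hσa
    have : (σ b : ℤ) = τ b := by exact_mod_cast congrArg Fin.val hσa
    omega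

/-- **Two-displacement rigidity.**  Two permutations of `Fin n` all of whose displacements `σ b − b` lie in the same
two-element set `{u, v}` (`u ≠ v`) are equal.  (Strong induction on the position; `false_of_two_displacements_step`.)
Hence a displacement profile with two values is realised by at most one permutation. [folklore] -/
theorem perm_eq_of_two_displacements (u v : ℤ) (huv : u ≠ v) (σ τ : Equiv.Perm (Fin n))
    (hσ : ∀ b, (σ b : ℤ) - b = u ∨ (σ b : ℤ) - b = v)
    (hτ : ∀ b, (τ b : ℤ) - b = u ∨ (τ b : ℤ) - b = v) : σ = τ := by
  suffices h : ∀ k : ℕ, ∀ b : Fin n, (b : ℕ) = k → σ b = τ b from Equiv.ext fun b => h b b rfl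
  intro k
  induction k using Nat.strong_induction_on with
  | _ k ih =>
    intro b hb
    have hagree : ∀ b' : Fin n, (b' : ℕ) < (b : ℕ) → σ b' = τ b' := fun b' hb' => ih b' (hb ▸ hb') b' rfl
    have hagree' : ∀ b' : Fin n, (b' : ℕ) < (b : ℕ) → τ b' = σ b' := fun b' hb' => (hagree b' hb').symm
    rcases lt_or_gt_of_ne huv with hlt | hlt
    · rcases hσ b with h1 | h1 <;> rcases hτ b with h2 | h2
      · exact Fin.ext (by omega)
      · exact (false_of_two_displacements_step τ σ v u hlt (fun b => (hτ b).symm) b hagree' h2 h1).elim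
      · exact (false_of_two_displacements_step σ τ v u hlt (fun b => (hσ b).symm) b hagree h1 h2).elim
      · exact Fin.ext (by omega)
    · rcases hσ b with h1 | h1 <;> rcases hτ b with h2 | h2
      · exact Fin.ext (by omega)
      · exact (false_of_two_displacements_step σ τ u v hlt hσ b hagree h1 h2).elim
      · exact (false_of_two_displacements_step τ σ u v hlt hτ b hagree' h2 h1).elim
      · exact Fin.ext (by omega)

/-- **Block rotations exist**: for `ℓ ∣ m` and `p < ℓ` there is a permutation of `Fin m` all of whose displacements are
`p` or `p − ℓ` — the `m/ℓ` consecutive blocks of length `ℓ`, each rotated by `p` (for `ℓ = m`, the rotation by `p`).  By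
`perm_eq_of_two_displacements` it is the only such permutation. [folklore] -/
theorem exists_perm_two_displacements {m ℓ p : ℕ} (hℓ : ℓ ∣ m) (hp : p < ℓ) :
    ∃ π : Equiv.Perm (Fin m), ∀ b, ((π b : ℤ) - b = p ∨ (π b : ℤ) - b = (p : ℤ) - ℓ) := by
  obtain ⟨k, hk⟩ := hℓ
  rw [mul_comm] at hk
  subst hk
  haveI : NeZero ℓ := ⟨by omega⟩
  refine ⟨(finProdFinEquiv.symm.trans
      ((Equiv.refl (Fin k)).prodCongr (Equiv.addRight (⟨p, hp⟩ : Fin ℓ)))).trans finProdFinEquiv, fun b => ?_⟩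
  obtain ⟨⟨i, j⟩, rfl⟩ := finProdFinEquiv.surjective b
  simp only [Equiv.trans_apply, Equiv.symm_apply_apply, Equiv.prodCongr_apply, Prod.map_apply, Equiv.refl_apply,
    Equiv.coe_addRight, finProdFinEquiv_apply_val]
  rw [Fin.val_add]
  have hj := j.isLt
  rcases lt_or_ge ((j : ℕ) + p) ℓ with h | h
  · left
    rw [Nat.mod_eq_of_lt h]
    push_cast
    ring
  · right
    have h2 : ((j : ℕ) + ((⟨p, hp⟩ : Fin ℓ) : ℕ)) % ℓ = (j : ℕ) + p - ℓ := by
      rw [Nat.mod_eq_sub_mod h, Nat.mod_eq_of_lt (by omega)]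
    rw [h2]
    have h3 : ℓ ≤ (j : ℕ) + p := h
    push_cast [h3]
    ring

/-- **The one-parameter (Lagrangian) certificate.**  If for some `L > 0`, `Λ` and `Mx` the function
`δ ↦ L·(θ ψ(δ) + α(δ)) − Λ·δ` is at most `Mx` on admissible entries and equals `Mx` along the admissible permutation `π`,
then `π` maximises `W_θ` among admissible permutations (displacements sum to zero, so `L·W_θ(σ) ≤ n·Mx = L·W_θ(π)`), and a
unique maximiser `τ` equals `π`. [folklore] -/
theorem toeplitz_twoPhase_opt_eq (ψ α : ℤ → ℤ) (P : ℤ → Prop) (θ L Λ Mx : ℤ) (hL : 0 < L)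
    (hmax : ∀ a b : Fin n, P ((a : ℤ) - b) →
      L * (θ * ψ ((a : ℤ) - b) + α ((a : ℤ) - b)) - Λ * ((a : ℤ) - b) ≤ Mx)
    (π : Equiv.Perm (Fin n)) (hπP : ∀ b, P ((π b : ℤ) - b))
    (hπ : ∀ b, L * (θ * ψ ((π b : ℤ) - b) + α ((π b : ℤ) - b)) - Λ * ((π b : ℤ) - b) = Mx)
    (τ : Equiv.Perm (Fin n)) (hτP : ∀ b, P ((τ b : ℤ) - b))
    (huniq : ∀ σ : Equiv.Perm (Fin n), σ ≠ τ → (∀ b, P ((σ b : ℤ) - b)) →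
      ∑ b, (θ * ψ ((σ b : ℤ) - b) + α ((σ b : ℤ) - b)) < ∑ b, (θ * ψ ((τ b : ℤ) - b) + α ((τ b : ℤ) - b))) :
    τ = π := by
  by_contra hne
  have hlt := huniq π (Ne.symm hne) hπP
  -- `L · W σ = Σ_b (L w(δ_b) − Λ δ_b) + Λ · Σ_b δ_b` and the last sum vanishes
  have key : ∀ σ : Equiv.Perm (Fin n), L * ∑ b, (θ * ψ ((σ b : ℤ) - b) + α ((σ b : ℤ) - b)) =
      ∑ b, (L * (θ * ψ ((σ b : ℤ) - b) + α ((σ b : ℤ) - b)) - Λ * ((σ b : ℤ) - b)) := by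
    intro σ
    have h0 := sum_displacement_eq_zero σ
    rw [sum_sub_distrib, ← mul_sum, ← mul_sum, h0, mul_zero, sub_zero]
  have h1 : L * ∑ b, (θ * ψ ((τ b : ℤ) - b) + α ((τ b : ℤ) - b)) ≤ ∑ _b : Fin n, Mx := by
    rw [key τ]
    exact sum_le_sum fun b _ => hmax (τ b) b (hτP b)
  have h2 : L * ∑ b, (θ * ψ ((π b : ℤ) - b) + α ((π b : ℤ) - b)) = ∑ _b : Fin n, Mx := by
    rw [key π]
    exact sum_congr rfl fun b _ => hπ b
  have h3 := mul_lt_mul_of_pos_left hlt hL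
  exact absurd (h2 ▸ h3) (not_lt.mpr h1)

/-- **Two-phase form.**  If the Lagrangian function `δ ↦ L·(θ ψ(δ) + α(δ)) − Λ·δ` (`L > 0`) is at most `Mx` on admissible
entries and attains `Mx` at the two displacement values `u`, `v`, and `π` is an admissible permutation with all
displacements in `{u, v}` (a block rotation, `exists_perm_two_displacements`, unique by `perm_eq_of_two_displacements`),
then a unique maximiser `τ` equals `π`: the two-point relaxation is tight and its optimum is integral. [folklore] -/
theorem toeplitz_twoPhase_opt_eq_of_pair (ψ α : ℤ → ℤ) (P : ℤ → Prop) (θ L Λ Mx : ℤ) (hL : 0 < L)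
    (hmax : ∀ a b : Fin n, P ((a : ℤ) - b) →
      L * (θ * ψ ((a : ℤ) - b) + α ((a : ℤ) - b)) - Λ * ((a : ℤ) - b) ≤ Mx)
    (u v : ℤ) (hu : L * (θ * ψ u + α u) - Λ * u = Mx) (hv : L * (θ * ψ v + α v) - Λ * v = Mx)
    (π : Equiv.Perm (Fin n)) (hπP : ∀ b, P ((π b : ℤ) - b))
    (hπuv : ∀ b, (π b : ℤ) - b = u ∨ (π b : ℤ) - b = v)
    (τ : Equiv.Perm (Fin n)) (hτP : ∀ b, P ((τ b : ℤ) - b))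
    (huniq : ∀ σ : Equiv.Perm (Fin n), σ ≠ τ → (∀ b, P ((σ b : ℤ) - b)) →
      ∑ b, (θ * ψ ((σ b : ℤ) - b) + α ((σ b : ℤ) - b)) < ∑ b, (θ * ψ ((τ b : ℤ) - b) + α ((τ b : ℤ) - b))) :
    τ = π :=
  toeplitz_twoPhase_opt_eq ψ α P θ L Λ Mx hL hmax π hπP
    (fun b => by rcases hπuv b with h | h <;> rw [h] <;> assumption) τ hτP huniq

/-- **Tight indices of a chain carry pairwise distinct value pairs.**  Along a family `τ` of pairwise distinct admissible
unique maximisers (at slopes `θ' k`), suppose every index `k` carries a two-phase certificate: a Lagrangian triple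
`(L k > 0, Λ k, Mx k)` bounding `L·w_{θ' k} − Λ·δ` on admissible entries by `Mx k`, attained at the values `u k ≠ v k`, and
an admissible permutation with displacements in `{u k, v k}`.  Then `k ↦ (u k, v k)` is injective: by
`toeplitz_twoPhase_opt_eq_of_pair` `τ k` is that permutation and by `perm_eq_of_two_displacements` the pair determines it.
[folklore] -/
theorem toeplitz_twoPhase_pairs_injective (ψ α : ℤ → ℤ) (P : ℤ → Prop) {N : ℕ} (θ' : Fin (N + 1) → ℤ)
    (τ : Fin (N + 1) → Equiv.Perm (Fin n)) (hinj : Function.Injective τ)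
    (hτP : ∀ k b, P ((τ k b : ℤ) - b))
    (huniq : ∀ k (σ : Equiv.Perm (Fin n)), σ ≠ τ k → (∀ b, P ((σ b : ℤ) - b)) →
      ∑ b, (θ' k * ψ ((σ b : ℤ) - b) + α ((σ b : ℤ) - b)) <
        ∑ b, (θ' k * ψ ((τ k b : ℤ) - b) + α ((τ k b : ℤ) - b)))
    (u v L Λ Mx : Fin (N + 1) → ℤ) (huv : ∀ k, u k ≠ v k) (hL : ∀ k, 0 < L k)
    (hmax : ∀ k (a b : Fin n), P ((a : ℤ) - b) →
      L k * (θ' k * ψ ((a : ℤ) - b) + α ((a : ℤ) - b)) - Λ k * ((a : ℤ) - b) ≤ Mx k)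
    (hu : ∀ k, L k * (θ' k * ψ (u k) + α (u k)) - Λ k * u k = Mx k)
    (hv : ∀ k, L k * (θ' k * ψ (v k) + α (v k)) - Λ k * v k = Mx k)
    (hex : ∀ k, ∃ π : Equiv.Perm (Fin n), (∀ b, P ((π b : ℤ) - b)) ∧ ∀ b, (π b : ℤ) - b = u k ∨ (π b : ℤ) - b = v k) :
    Function.Injective fun k => (u k, v k) := by
  -- every `τ k` is the two-phase permutation of its pair
  have hτuv : ∀ k b, (τ k b : ℤ) - b = u k ∨ (τ k b : ℤ) - b = v k := by
    intro k
    obtain ⟨π, hπP, hπuv⟩ := hex k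
    have := toeplitz_twoPhase_opt_eq_of_pair ψ α P (θ' k) (L k) (Λ k) (Mx k) (hL k) (hmax k) (u k) (v k) (hu k) (hv k)
      π hπP hπuv (τ k) (hτP k) (huniq k)
    rw [this]
    exact hπuv
  intro k k' h
  simp only [Prod.mk.injEq] at h
  apply hinj
  refine perm_eq_of_two_displacements (u k) (v k) (huv k) (τ k) (τ k') (hτuv k) fun b => ?_
  rw [h.1, h.2]
  exact hτuv k' b

/-- **Count of tight indices.**  In the situation of `toeplitz_twoPhase_pairs_injective`, if the certifying values satisfy
`0 ≤ u k < n` and `0 ≤ −v k < n` (a nonnegative and a nonpositive displacement of `Fin n`), the family has at most `n²`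
members: `N + 1 ≤ n · n`.  (On paper the certifying pairs are edges of the spatial convex hull of `{(δ, ψ δ, α δ)}`
crossing `δ = 0`, hence `O(n)`; the quadratic count is what the injectivity gives without planar-graph counting.)
[folklore] -/
theorem toeplitz_twoPhase_chain_le (ψ α : ℤ → ℤ) (P : ℤ → Prop) {N : ℕ} (θ' : Fin (N + 1) → ℤ)
    (τ : Fin (N + 1) → Equiv.Perm (Fin n)) (hinj : Function.Injective τ)
    (hτP : ∀ k b, P ((τ k b : ℤ) - b))
    (huniq : ∀ k (σ : Equiv.Perm (Fin n)), σ ≠ τ k → (∀ b, P ((σ b : ℤ) - b)) →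
      ∑ b, (θ' k * ψ ((σ b : ℤ) - b) + α ((σ b : ℤ) - b)) <
        ∑ b, (θ' k * ψ ((τ k b : ℤ) - b) + α ((τ k b : ℤ) - b)))
    (u v L Λ Mx : Fin (N + 1) → ℤ) (huv : ∀ k, u k ≠ v k) (hL : ∀ k, 0 < L k)
    (hmax : ∀ k (a b : Fin n), P ((a : ℤ) - b) →
      L k * (θ' k * ψ ((a : ℤ) - b) + α ((a : ℤ) - b)) - Λ k * ((a : ℤ) - b) ≤ Mx k)
    (hu : ∀ k, L k * (θ' k * ψ (u k) + α (u k)) - Λ k * u k = Mx k)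
    (hv : ∀ k, L k * (θ' k * ψ (v k) + α (v k)) - Λ k * v k = Mx k)
    (hex : ∀ k, ∃ π : Equiv.Perm (Fin n), (∀ b, P ((π b : ℤ) - b)) ∧ ∀ b, (π b : ℤ) - b = u k ∨ (π b : ℤ) - b = v k)
    (hrange : ∀ k, (0 ≤ u k ∧ u k < n) ∧ (0 ≤ -v k ∧ -v k < n)) :
    N + 1 ≤ n * n := by
  have hpi := toeplitz_twoPhase_pairs_injective ψ α P θ' τ hinj hτP huniq u v L Λ Mx huv hL hmax hu hv hex
  -- encode the pair `(u k, −v k)` in `Fin n × Fin n`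
  let e : Fin (N + 1) → Fin n × Fin n := fun k =>
    (⟨(u k).toNat, by have := (hrange k).1; omega⟩, ⟨(-v k).toNat, by have := (hrange k).2; omega⟩)
  have he : Function.Injective e := by
    intro k k' h
    simp only [e, Prod.mk.injEq, Fin.mk.injEq] at h
    apply hpi
    have h1 := (hrange k).1; have h2 := (hrange k).2; have h3 := (hrange k').1; have h4 := (hrange k').2
    simp only [Prod.mk.injEq]
    constructor <;> omega
  simpa using Fintype.card_le_of_injective e he

end TwoPhase

end Summit.ValiantsHypothesis.ValiantsHypothesis.Theorems.KPlusLogSqLaw
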